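import Summits.BirchSwinnertonDyer.Rank1Residual.X1.RelaxedKummerCountPow
import Summits.BirchSwinnertonDyer.Rank1Residual.X1.GeneratorCountLayerLocal
import HarnessLib

/-!
# Route M's generator COUNT at LAYER `n`, VIII: the layer-`n` count over `K_n` with the local term
# at one place imposed in the `K`-FRAMEWORK (cell `b2b-bsdres`, unit `b2b-bsdres-eisenstein-p1`,
# gen 19; X1R0-GAPMAP §28, memo `V76-LOCAL-TERM-PLAN.md` §4.5 route R1′)

HONEST FRAMING (run/shared/lean/b2b/bsd-rank1-residual/, verbatim in every file): the goal of the
cell is to DELETE the COMBINATION-SHAPED residual classes of the Birch–Swinnerton-Dyer formula for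
ALL analytic-rank `≤ 1` elliptic curves over `ℚ` — "full BSD formula for every rank `≤ 1` curve in
class `C`" assembled STRICTLY from published theorems — so that the rank-`≤ 1` remainder becomes
exactly the CONSTRUCTION-SHAPED classes, which are TYPED (missing-input `Prop`s), NOT attempted.
This is not "finishing BSD". Sub-cell `b2b-bsdres-eisenstein-p1` (CLASS-OWNERS row "X1 (r = 0)"):
research route; NO CLAIM BEYOND STATED CLASSES; nothing here changes a label; nothing is booked.
THEOREMS ONLY — no definition, no named fact, no typed input introduced; the local data at the place
`wp` of `K_n` above `v₀` (`𝓛`, its index `p^e`, the `K_∞`-condition of its classes at `v₀`), the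
Poitou–Tate family and the local Euler–Poincaré formula are HYPOTHESES; nothing about any particular
curve asserted.

## What and why

K-GENERAL form of FILE 9 §3 (`X1/GeneratorCountLayerAtP.succ_card_le_lambda_add_pow_mul_mu_of_tamagawaWitnesses_layer_at`)
in the `K`-framework of route R1′: for `E/K`, a `ℤ_p`-extension `κ`, its layer `K_n` with restricted
tower `κ_n`, a dual datum `D` of `Sel_{p^∞}(E/K_∞)`, a finite place `v₀` of `K` and a place
`wp ∣ v₀` of `K_n`: Tamagawa witnesses on `T₀` (places `w ∤ p`), a local condition `𝓛 ⊇ 𝓚_wp` at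
`wp` of index `≥ p^e` (FILE 24a `RelaxedKummerCountPow`), and — instead of FILE 9's `K_{n,∞}`-level
hypothesis `hloc` — the `K_∞`-LEVEL condition at `v₀`: for every `y ∈ H¹(K_n, E[p])` with
`res_wp y ∈ 𝓛_wp`, all `Γ_K`-conjugates of `kerH1Iso (h'_0 (Ψ y))` lie in `localKerOver p (ker κ) K_{v₀}`
(`hv₀`). Conclusions (FILE 23b `GeneratorCountLayerLocal` + FILE 5):

* `pow_card_add_le_natCard_quotient_layerIdeal_mul_sq` (ANY `E(K)[p]`):
  **`p^{#T₀ + e} ≤ #(X/I_nX) · (#E[p^∞]^{Γ_{K_n}})²`**, `I_n = (p, (1+T)^{pⁿ} − 1)`;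
* `pow_card_add_le_pow_mul_sq`: **`p^{#T₀ + e} ≤ p^{λ + pⁿμ} · (#E[p^∞]^{Γ_{K_n}})²`**;
* `card_add_le_lambda_add_pow_mul_mu` (`E(K)[p] = 0`): **`#T₀ + e ≤ λ + pⁿμ`**.

Over `ℚ` with `κ` cyclotomic and `v₀ = p`, `hv₀` is supplied by STRICTNESS AT `p` (FILE 21
`StrictAtPOfInertiaTransported` + FILE 22 `LocalKerOverAtPConj`) in the sequel
`X1/GeneratorCountLayerAtPStrict.lean`; this file is kept in the import context of FILES 6–9 (the
K_n-level types of FILE 24a's subgroup and FILE 23b's count agree here; X1R0-GAPMAP §27.3).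

References: [GreenbergLNM1716] §3 Lemma 3.1, Lemma 3.4, §5 pp. 114–118, p. 137; [MilneADT2006]
Ch. I Thm. 2.8, Thm. 4.10; X1R0-GAPMAP §14.1, §26–§28.
-/

noncomputable section

open scoped Classical

open Function Field NumberField IsDedekindDomain WeierstrassCurve PowerSeries
  Literature.NumberTheory.EllipticCurves Literature.NumberTheory.GaloisRepresentations
  Literature.NumberTheory.GaloisCohomology Summit.BirchSwinnertonDyer.Rank1Residual.GaloisImage
  Literature.NumberTheory.EllipticCurves.IwasawaAlgebra
  Summit.BirchSwinnertonDyer.Rank1Residual.Additive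
  Summit.BirchSwinnertonDyer.Rank1Residual.Additive.ZpTower
  Summit.BirchSwinnertonDyer.Rank1Residual.X1.GeneratorBoundMuLayer
  Summit.BirchSwinnertonDyer.Rank1Residual.X1.GeneratorCountLayerTransport
  Summit.BirchSwinnertonDyer.Rank1Residual.X1.RelaxedKummerCountPow
open Literature.NumberTheory.GaloisRepresentations.DiscreteGaloisModule (SelmerStructure unramifiedSubgroup)

set_option autoImplicit false

namespace Summit.BirchSwinnertonDyer.Rank1Residual.X1.GeneratorCountLayerAtV0

variable {K : Type} [Field K] [NumberField K] {W : WeierstrassCurve K} [W.IsElliptic] {p : ℕ}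
  [hp : Fact p.Prime] {κ : ZpExtension K p} (n : ℕ) (κn : ZpExtension (κ.layer n) p)
  (hκn : ∀ σ : Field.absoluteGaloisGroup (κ.layer n),
    (κn σ).toAdd * (p : ℤ_[p]) ^ n = (κ (resGal (K := K) (κ.layer n) σ)).toAdd)
  {γ : Field.absoluteGaloisGroup K} (D : W.SelmerDualData κ γ)

include hκn

/-- **The layer-`n` count with the local term imposed over `K_∞` at `v₀`, LOSSY form (any
`E(K)[p]`): `p^{#T₀ + e} ≤ #(X/I_nX) · (#E[p^∞]^{Γ_{K_n}})²`.** Hypotheses: `p` odd, `κ` cyclotomic,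
`E(K_{n,∞})[p^∞]` finite; a Poitou–Tate family and the local Euler–Poincaré formula over `K_n`; `T₀`
places `w ∤ p` of `K_n` with Tamagawa witnesses; `wp ∣ v₀`, `wp ∉ T₀`, a local condition `𝓛 ⊇ 𝓚_wp`
at `wp` with `p^e·#𝓚_wp ≤ #𝓛`; `hv₀`: every `y` with `res_wp y ∈ 𝓛_wp` has all conjugates of its
transport in `localKerOver p (ker κ) K_{v₀}`. FILE 24a's subgroup counted by FILE 23b.
[cite: GreenbergLNM1716, §3 Lemma 3.1, Lemma 3.4, §5 pp. 114–118] -/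
theorem pow_card_add_le_natCard_quotient_layerIdeal_mul_sq
    [Module.Finite (IwasawaAlgebra p) D.X] [NumberField (κ.layer n)]
    [Finite (FixedPoints.addSubgroup κn.kerSubgroup
      (geomPrimaryTorsion (W.baseChange (κ.layer n)) p))]
    (hodd : p ≠ 2) (hκ : κ.IsCyclotomic)
    (inv : LocalInvariants (κ.layer n) p) (hperf : inv.IsPerfect) (hsum : inv.SumLocalTermEqZero)
    (hcompl : inv.SelmerComplement)
    (hEP : ∀ w : HeightOneSpectrum (𝓞 (κ.layer n)),
      localEulerPoincareCharacteristic (w.adicCompletion (κ.layer n)))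
    (T₀ : Finset (HeightOneSpectrum (𝓞 (κ.layer n))))
    (hT₀p : ∀ w ∈ T₀, ((p : ℕ) : 𝓞 (κ.layer n)) ∉ w.asIdeal)
    (hwit : ∀ w ∈ T₀, ∃ u ∈ unramifiedSubgroup
        (((W.baseChange (κ.layer n)).torsionGaloisModule (p : ℤ)).restrictField
          (w.adicCompletion (κ.layer n))) 1,
      u ∉ (W.baseChange (κ.layer n)).kummerLocalConditionAt (p : ℤ) (w.adicCompletion (κ.layer n)))
    (v₀ : HeightOneSpectrum (𝓞 K)) (wp : HeightOneSpectrum (𝓞 (κ.layer n))) (hwpT₀ : wp ∉ T₀)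
    (hwpv : wp.asIdeal.LiesOver v₀.asIdeal)
    (𝓛 : ∀ w : HeightOneSpectrum (𝓞 (κ.layer n)), AddSubgroup (galoisCohomology
      (((W.baseChange (κ.layer n)).torsionGaloisModule (p : ℤ)).toLocal (Sum.inr w)) 1))
    (h𝓛 : (W.baseChange (κ.layer n)).kummerSelmerStructure (p : ℤ) (Sum.inr wp) ≤ 𝓛 wp) (e : ℕ)
    (hidx : p ^ e * Nat.card ((W.baseChange (κ.layer n)).kummerSelmerStructure (p : ℤ) (Sum.inr wp)) ≤
      Nat.card (𝓛 wp))
    (hv₀ : ∀ y : galH1Torsion (W.baseChange (κ.layer n)) (p : ℤ),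
      galoisCohomology.localization ((W.baseChange (κ.layer n)).torsionGaloisModule (p : ℤ))
        (Sum.inr wp) 1 y ∈ 𝓛 wp →
      ∀ σ : Field.absoluteGaloisGroup K, W.conjH1 p κ.kerSubgroup σ
        (kerH1Iso W κ n κn hκn ((W.baseChange (κ.layer n)).layerToInfty κn 0
          (resH1Hom (Literature.NumberTheory.EllipticCurves.subgroupIncl (κn.layerSubgroup 0))
            (AddMonoidHom.id (geomPrimaryTorsion (W.baseChange (κ.layer n)) p)) (fun _ _ ↦ rfl)
            (torsionToPrimaryH1 (W.baseChange (κ.layer n)) p y)))) ∈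
        W.localKerOver p κ.kerSubgroup (v₀.adicCompletion K)) :
    p ^ (T₀.card + e) ≤ Nat.card (D.X ⧸ Ideal.span {(C (p : ℤ_[p]) : IwasawaAlgebra p),
        (1 + (X : IwasawaAlgebra p)) ^ p ^ n - 1} • (⊤ : Submodule (IwasawaAlgebra p) D.X)) *
      Nat.card {a : geomPrimaryTorsion (W.baseChange (κ.layer n)) p //
        ∀ σ : Field.absoluteGaloisGroup (κ.layer n), σ • a = a} ^ 2 := by
  have hκnc : κn.IsCyclotomic := ZpTower.isCyclotomic_restrictTower κ n κn hκn hκ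
  obtain ⟨S, hSfin, hcard, hS⟩ := exists_addSubgroup_relaxedKummer_at_pow
    (W := W.baseChange (κ.layer n)) hodd inv hperf hsum hcompl hEP T₀ hwit wp hwpT₀ 𝓛 h𝓛 e hidx
  haveI := hSfin
  refine hcard.trans (GeneratorCountLayerLocal.natCard_le_natCard_quotient_layerIdeal_mul_sq_of_local
    n κn hκn D S v₀ (↑T₀ : Set (HeightOneSpectrum (𝓞 (κ.layer n))))
    (fun y hy w hwT hwv ↦ (hS y hy).1 w ?_) (fun y hy w ↦ (hS y hy).2.1 w) (fun y hy w hw ↦ ?_)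
    (fun y hy σ ↦ hv₀ y (hS y hy).2.2.2 σ))
  · rw [Finset.coe_insert, Set.mem_insert_iff, not_or]
    exact ⟨fun h ↦ hwv (h ▸ hwpv), hwT⟩
  · have hw' : w ∈ T₀ := Finset.mem_coe.mp hw
    exact Additive.layerToInfty_resH1Hom_torsionToPrimaryH1_mem_localKerOver_of_mem_unramified_sup_kummer
      (W.baseChange (κ.layer n)) p κn w (hT₀p w hw')
      (Additive.exists_apply_resGal_ne_one_of_isCyclotomic κn hκnc w (hT₀p w hw')) y
      ((hS y hy).2.2.1 w hw')

/-- **… in `λ`, `μ`: `p^{#T₀ + e} ≤ p^{λ(X) + pⁿμ(X)} · (#E[p^∞]^{Γ_{K_n}})²`** when `X` is torsion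
without non-zero finite submodules (FILE 5 `natCard_quotient_layerIdeal_le_pow`) — X1R0-GAPMAP
§14.1's `t_n + a − 2δ ≤ λ + pⁿμ` with `a = e`. [cite: GreenbergLNM1716, §3 Lemma 3.1, §5 pp. 114–118, p. 137] -/
theorem pow_card_add_le_pow_mul_sq
    [Module.Finite (IwasawaAlgebra p) D.X] [NumberField (κ.layer n)]
    [Finite (FixedPoints.addSubgroup κn.kerSubgroup
      (geomPrimaryTorsion (W.baseChange (κ.layer n)) p))]
    (hodd : p ≠ 2) (hX : D.IsTorsion) (hnf : ∀ N : Submodule (IwasawaAlgebra p) D.X, Finite N → N = ⊥)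
    (hκ : κ.IsCyclotomic)
    (inv : LocalInvariants (κ.layer n) p) (hperf : inv.IsPerfect) (hsum : inv.SumLocalTermEqZero)
    (hcompl : inv.SelmerComplement)
    (hEP : ∀ w : HeightOneSpectrum (𝓞 (κ.layer n)),
      localEulerPoincareCharacteristic (w.adicCompletion (κ.layer n)))
    (T₀ : Finset (HeightOneSpectrum (𝓞 (κ.layer n))))
    (hT₀p : ∀ w ∈ T₀, ((p : ℕ) : 𝓞 (κ.layer n)) ∉ w.asIdeal)
    (hwit : ∀ w ∈ T₀, ∃ u ∈ unramifiedSubgroup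
        (((W.baseChange (κ.layer n)).torsionGaloisModule (p : ℤ)).restrictField
          (w.adicCompletion (κ.layer n))) 1,
      u ∉ (W.baseChange (κ.layer n)).kummerLocalConditionAt (p : ℤ) (w.adicCompletion (κ.layer n)))
    (v₀ : HeightOneSpectrum (𝓞 K)) (wp : HeightOneSpectrum (𝓞 (κ.layer n))) (hwpT₀ : wp ∉ T₀)
    (hwpv : wp.asIdeal.LiesOver v₀.asIdeal)
    (𝓛 : ∀ w : HeightOneSpectrum (𝓞 (κ.layer n)), AddSubgroup (galoisCohomology
      (((W.baseChange (κ.layer n)).torsionGaloisModule (p : ℤ)).toLocal (Sum.inr w)) 1))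
    (h𝓛 : (W.baseChange (κ.layer n)).kummerSelmerStructure (p : ℤ) (Sum.inr wp) ≤ 𝓛 wp) (e : ℕ)
    (hidx : p ^ e * Nat.card ((W.baseChange (κ.layer n)).kummerSelmerStructure (p : ℤ) (Sum.inr wp)) ≤
      Nat.card (𝓛 wp))
    (hv₀ : ∀ y : galH1Torsion (W.baseChange (κ.layer n)) (p : ℤ),
      galoisCohomology.localization ((W.baseChange (κ.layer n)).torsionGaloisModule (p : ℤ))
        (Sum.inr wp) 1 y ∈ 𝓛 wp →
      ∀ σ : Field.absoluteGaloisGroup K, W.conjH1 p κ.kerSubgroup σ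
        (kerH1Iso W κ n κn hκn ((W.baseChange (κ.layer n)).layerToInfty κn 0
          (resH1Hom (Literature.NumberTheory.EllipticCurves.subgroupIncl (κn.layerSubgroup 0))
            (AddMonoidHom.id (geomPrimaryTorsion (W.baseChange (κ.layer n)) p)) (fun _ _ ↦ rfl)
            (torsionToPrimaryH1 (W.baseChange (κ.layer n)) p y)))) ∈
        W.localKerOver p κ.kerSubgroup (v₀.adicCompletion K)) :
    p ^ (T₀.card + e) ≤ p ^ (lambdaInvariant p D.X + p ^ n * muInvariant p D.X) *
      Nat.card {a : geomPrimaryTorsion (W.baseChange (κ.layer n)) p //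
        ∀ σ : Field.absoluteGaloisGroup (κ.layer n), σ • a = a} ^ 2 :=
  (pow_card_add_le_natCard_quotient_layerIdeal_mul_sq n κn hκn D hodd hκ inv hperf hsum hcompl hEP T₀
    hT₀p hwit v₀ wp hwpT₀ hwpv 𝓛 h𝓛 e hidx hv₀).trans
    (Nat.mul_le_mul_right _ (natCard_quotient_layerIdeal_le_pow D.X hX hnf n))

/-- **The layer-`n` count with the local term imposed over `K_∞` at `v₀`, at `E(K)[p] = 0`:
`#T₀ + e ≤ λ(X) + pⁿ μ(X)`** — FILE 9 §3 with `hloc` replaced by `hv₀` and the index `p^e`.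
[cite: GreenbergLNM1716, §3 Lemma 3.4, §5 pp. 114–118, p. 137] -/
theorem card_add_le_lambda_add_pow_mul_mu
    [Module.Finite (IwasawaAlgebra p) D.X] [NumberField (κ.layer n)] (hodd : p ≠ 2)
    (hX : D.IsTorsion) (hnf : ∀ N : Submodule (IwasawaAlgebra p) D.X, Finite N → N = ⊥)
    (hK : ∀ P : W.toAffine.Point, p • P = 0 → P = 0) (hκ : κ.IsCyclotomic)
    (inv : LocalInvariants (κ.layer n) p) (hperf : inv.IsPerfect) (hsum : inv.SumLocalTermEqZero)
    (hcompl : inv.SelmerComplement)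
    (hEP : ∀ w : HeightOneSpectrum (𝓞 (κ.layer n)),
      localEulerPoincareCharacteristic (w.adicCompletion (κ.layer n)))
    (T₀ : Finset (HeightOneSpectrum (𝓞 (κ.layer n))))
    (hT₀p : ∀ w ∈ T₀, ((p : ℕ) : 𝓞 (κ.layer n)) ∉ w.asIdeal)
    (hwit : ∀ w ∈ T₀, ∃ u ∈ unramifiedSubgroup
        (((W.baseChange (κ.layer n)).torsionGaloisModule (p : ℤ)).restrictField
          (w.adicCompletion (κ.layer n))) 1,
      u ∉ (W.baseChange (κ.layer n)).kummerLocalConditionAt (p : ℤ) (w.adicCompletion (κ.layer n)))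
    (v₀ : HeightOneSpectrum (𝓞 K)) (wp : HeightOneSpectrum (𝓞 (κ.layer n))) (hwpT₀ : wp ∉ T₀)
    (hwpv : wp.asIdeal.LiesOver v₀.asIdeal)
    (𝓛 : ∀ w : HeightOneSpectrum (𝓞 (κ.layer n)), AddSubgroup (galoisCohomology
      (((W.baseChange (κ.layer n)).torsionGaloisModule (p : ℤ)).toLocal (Sum.inr w)) 1))
    (h𝓛 : (W.baseChange (κ.layer n)).kummerSelmerStructure (p : ℤ) (Sum.inr wp) ≤ 𝓛 wp) (e : ℕ)
    (hidx : p ^ e * Nat.card ((W.baseChange (κ.layer n)).kummerSelmerStructure (p : ℤ) (Sum.inr wp)) ≤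
      Nat.card (𝓛 wp))
    (hv₀ : ∀ y : galH1Torsion (W.baseChange (κ.layer n)) (p : ℤ),
      galoisCohomology.localization ((W.baseChange (κ.layer n)).torsionGaloisModule (p : ℤ))
        (Sum.inr wp) 1 y ∈ 𝓛 wp →
      ∀ σ : Field.absoluteGaloisGroup K, W.conjH1 p κ.kerSubgroup σ
        (kerH1Iso W κ n κn hκn ((W.baseChange (κ.layer n)).layerToInfty κn 0
          (resH1Hom (Literature.NumberTheory.EllipticCurves.subgroupIncl (κn.layerSubgroup 0))
            (AddMonoidHom.id (geomPrimaryTorsion (W.baseChange (κ.layer n)) p)) (fun _ _ ↦ rfl)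
            (torsionToPrimaryH1 (W.baseChange (κ.layer n)) p y)))) ∈
        W.localKerOver p κ.kerSubgroup (v₀.adicCompletion K)) :
    T₀.card + e ≤ lambdaInvariant p D.X + p ^ n * muInvariant p D.X := by
  have hκnc : κn.IsCyclotomic := ZpTower.isCyclotomic_restrictTower κ n κn hκn hκ
  obtain ⟨S, hSfin, hcard, hS⟩ := exists_addSubgroup_relaxedKummer_at_pow
    (W := W.baseChange (κ.layer n)) hodd inv hperf hsum hcompl hEP T₀ hwit wp hwpT₀ 𝓛 h𝓛 e hidx
  haveI := hSfin
  have hcount := GeneratorCountLayerLocal.natCard_le_natCard_quotient_layerIdeal_of_local n κn hκn D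
    hK S v₀ (↑T₀ : Set (HeightOneSpectrum (𝓞 (κ.layer n))))
    (fun y hy w hwT hwv ↦ (hS y hy).1 w (by
      rw [Finset.coe_insert, Set.mem_insert_iff, not_or]
      exact ⟨fun h ↦ hwv (h ▸ hwpv), hwT⟩))
    (fun y hy w ↦ (hS y hy).2.1 w)
    (fun y hy w hw ↦ by
      have hw' : w ∈ T₀ := Finset.mem_coe.mp hw
      exact Additive.layerToInfty_resH1Hom_torsionToPrimaryH1_mem_localKerOver_of_mem_unramified_sup_kummer
        (W.baseChange (κ.layer n)) p κn w (hT₀p w hw')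
        (Additive.exists_apply_resGal_ne_one_of_isCyclotomic κn hκnc w (hT₀p w hw')) y
        ((hS y hy).2.2.1 w hw'))
    (fun y hy σ ↦ hv₀ y (hS y hy).2.2.2 σ)
  exact (Nat.pow_le_pow_iff_right (Nat.Prime.one_lt hp.out)).mp
    ((hcard.trans hcount).trans (natCard_quotient_layerIdeal_le_pow D.X hX hnf n))

end Summit.BirchSwinnertonDyer.Rank1Residual.X1.GeneratorCountLayerAtV0

end
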